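import Mathlib
import Summits.NavierStokesRegularity.NavierStokesRegularity.Theorems.TaoLadderRungTwoFlatConditionalBlock
import Summits.NavierStokesRegularity.NavierStokesRegularity.Theorems.TaoLadderRungTwoFlatNearBehindStepIface
import HarnessLib

/-!
# THE INTERFACE LOOP OF RECORD FOR ONE PREMISE ON A SUB-HORIZON (tube hops `n > N₀`; input of the tube-hop interface bootstrap
  `…TubeBlockFlow`)
  (helper for the K_A♭ parent item stmt-NavierStokesRegularity-22987 `FlatGapCertificatesV2`, child 2A, route TaoLadderRungTwoFlat;
  cell harvest/h2-tao-ladder, p1 g25; theory-1 W-34 «tube-phase Λ» / A70-3 at hops `n > N₀`)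

At a tube hop the three flow-dependent inputs of `tubeStep_of_schedule_split` (…TubeStepSplit) that an enclosure produces are the
deeper core input `hcore2` (`|(S − W z)₀(2−K, ·)| ≤ ρ₂` on `[0, t]`), the ahead window readout `hwinA` and the window-top hull `hVt`;
the core landing contract `CoreLandingFromZ` is ALREADY conditional on the interface levels at `1−K`. An enclosure of the core block
`[2−K, k_B]` of the infinite lattice is honest only CONDITIONALLY on boxes at its two interfaces: the near shell `1−K` (deviation from
`W z` below the fat levels `2·RBAR`, `2·BBAR`) and the shell `k_B + 1` (`|S| ≤ 4G`). This module closes the condition per premise: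
* `interfaceLevels_flow` / `interfaceLevels_flow_at` (loop horizon `t' ≤ τ` and closing horizon `c₀` separated, for the short
  flows of the K4 argument) — the interface loop of record (`R54.interface_apriori_of_pseudoFlows`, per flow) for ONE premise of hop
  `n > N₀` on ANY sub-horizon `[0, t']`, `0 < t' ≤ c₀`, from its section datum and its core input on `[0, t']` (the body of
  `interfaceLevels_of_schedule_iface`, …NearBehindStepIface, with the good time replaced by `t'`; generic `Bcl ⇒ behindR54`);
* `tubeBlock_closure` — the JOINT BOOTSTRAP: conditional core-block row + `interfaceLevels_flow` below + `aheadCutStep_flow` above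
  (uniform family bootstrap over the four interface quantities, Lipschitz moduli from the two flows' qualitative a-priori bounds)
  ⇒ on all of `[0, c₀]`: the block deviation `|(S − W z)_{ik}| ≤ D_k` (`2−K ≤ k ≤ k_B`), the interface levels `(RBAR, BBAR)` at
  `1−K`, and the cut envelope `|S_{im}| ≤ 2G` beyond `k_B`.

HONEST FRAMING: bookkeeping and one continuity argument over the cell's typed frame (MODEL lattice); the conditional block row is a
BOOKED HYPOTHESIS; nothing certified; no item closed; nothing about the Navier–Stokes equations.
-/

noncomputable section

-- the sub-problem namespace repeats the summit name by design (D-0017)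
set_option linter.dupNamespace false

namespace Summit.NavierStokesRegularity.NavierStokesRegularity.Theorems.HopTube

open Set Finset Filter Topology Literature.Analysis.FluidPDE Literature.Analysis.FluidPDE.TaoCascade MirrorPulse RenormFrame QuadPolar
  GappedFrontRobustOn

section Flow

variable {ε ε₀ : ℝ}

set_option maxHeartbeats 400000 in
/-- **THE INTERFACE LOOP OF RECORD FOR ONE PREMISE ON A SUB-HORIZON.** For one premise of a tube hop `n > N₀` (`Bcl ⇒ behindR54`),
`0 < t' ≤ c₀`, its section datum `|(S − W z)ᵢ(1−K, 0)| ≤ r_s` and its deeper core input `|(S − W z)₀(2−K, ·)| ≤ ρ₂` on `[0, t']`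
give the interface deviations `≤ (RBAR, BBAR)` on `[0, t']` under the schedule of `interfaceLevels_of_schedule_iface`.
[cite: Tao2016AveragedNS, §4 (4.1), (4.3), (4.5), (4.8), §6.3–6.4 (statement shape); cell LADDER §59–§61 (interface loop), §70 (A70-3, W-34)] -/
theorem interfaceLevels_flow (P : TubeSchedule) {θ' : ℝ} {Wb : ℕ → ℝ} {i₀ : Fin 2}
    {Bcl : ℕ → (Fin 2 → ℤ → ℝ) → Prop} (hBcl : ∀ m z, Bcl m z → behindR54 P θ' Wb m z)
    {X₀ : Fin 2 → ℝ} {w : ℤ → ℝ} {r c₀ : ℝ} {ζ : ℕ → Fin 2 → ℤ → ℝ} {ustar : Fin 2 → ℤ → ℝ} {n : ℕ}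
    {cW κ₂ : ℝ} {W₀ FW₀ BW₀ : (Fin 2 → ℤ → ℝ) → Fin 2 → ℤ → ℝ} {W FW : (Fin 2 → ℤ → ℝ) → Fin 2 → ℤ → ℝ → ℝ}
    (hWflow : ∀ z, InTubeWith P Bcl i₀ X₀ w r ζ ustar n z →
      PseudoFlowOnShift shiftSetFlat cW ε₀ (mirrorTable ε ε) 0 κ₂ (W₀ z) (FW₀ z) (BW₀ z) (W z) (FW z)) (hcW : c₀ ≤ cW)
    (hε : 0 ≤ ε) (hε₀ : 0 < ε₀) (hn : P.N₀ < n) (hK : 1 ≤ P.K) (hDK : P.K + 1 ≤ P.D) (hθV : 0 < P.θV)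
    (hθ : 0 < θ') (hθ5 : θ' ≤ 5 * Real.log (1 + ε₀)) (hw1 : ∀ k, 1 ≤ w k) (hr0 : 0 ≤ r)
    (hAstar : 0 < P.Astar) {ωK MuK : ℝ} (hωK : 0 < ωK)
    (hωKle : ∀ i, ωK ≤ MirrorPulse.geomGauge P.g P.b i (-(P.K : ℤ))) (hMuK : ∀ i, |ustar i (-(P.K : ℤ))| ≤ MuK)
    (hWbn : 0 ≤ Wb n)
    {Aeff A A₀ A₁ M M₁ M₂ rI RBAR BBAR RHO2 rs I₁ I₂ PUMP μN μB VbarN VbarB EW V₀N V₀B EN : ℝ}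
    (hAeff : 0 < Aeff) (hM0 : 0 ≤ M)
    (hM : ∀ z, InTubeWith P Bcl i₀ X₀ w r ζ ustar n z →
      ∀ s ∈ Icc 0 c₀, ∀ i, ∀ m ∈ Finset.Icc (-(P.D : ℤ)) (1 - (P.K : ℤ)), |W z i m s| ≤ M)
    (hM₁ : ∀ z, InTubeWith P Bcl i₀ X₀ w r ζ ustar n z → ∀ s ∈ Icc 0 c₀, |W z 1 (-(P.K : ℤ)) s| ≤ M₁)
    (hM₂0 : 0 ≤ M₂)
    (hM₂ : ∀ z, InTubeWith P Bcl i₀ X₀ w r ζ ustar n z → ∀ s ∈ Icc 0 c₀, |W z 0 (2 - (P.K : ℤ)) s| ≤ M₂)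
    (hEW : ∀ z, InTubeWith P Bcl i₀ X₀ w r ζ ustar n z →
      coMovingEnergyOn (Finset.Icc (1 - (P.D : ℤ)) (-(P.K : ℤ))) P.θV (-(P.K : ℝ))
        (fun i k _ => anchorScale P i₀ z * ustar i k - W₀ z i k) 0 ≤ EW)
    (hρ0 : 0 ≤ RHO2)
    (hRB0 : 0 ≤ RBAR) (hBB0 : 0 ≤ BBAR) (hRr : RBAR ≤ rI) (hBr : BBAR ≤ rI) (hVN0 : 0 ≤ VbarN)
    (hI₁0 : 0 ≤ I₁) (hI₂0 : 0 ≤ I₂)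
    (hI₁ : 2 * (Real.exp (P.θV / 2) - 1) ≤ I₁ * P.θV) (hI₂ : Real.exp P.θV - 1 ≤ I₂ * P.θV)
    (hPUMPdef : PUMP = 1 * c₀ * ((2 + ε) * M * I₁ * Real.sqrt (2 * VbarN) + 2 * I₂ * VbarN))
    (hlevC : rs + PUMP + 1 * c₀ * ((ε * (M + I₁ * Real.sqrt (2 * VbarN)) + ε * M + ε * BBAR) * RBAR
      + (2 + ε) * M * BBAR + BBAR ^ 2) < RBAR)
    (hlevV : rs + 1 * c₀ * ((M + M₂ + RBAR + RHO2) * BBAR + (1 + 2 * ε) * M * RBAR + ε * RBAR ^ 2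
      + (M + 2 * ε * M₂) * RHO2 + ε * RHO2 ^ 2) < BBAR)
    (hAdef : A = Real.sqrt (2 * VbarB) * Real.exp (θ' / 2) * Real.exp (θ' * ((P.D : ℝ) - P.K) / 2) + M)
    (hA₀def : A₀ = M + rI) (hA₁def : A₁ = M₁ + Real.sqrt (2 * VbarN) * Real.exp (P.θV / 2))
    (hrA : rI ≤ A) (hA₀le : A₀ ≤ Aeff)
    (hV₀Ndef : V₀N = (Real.sqrt (P.v n + (P.δ n / ωK) ^ 2) + Real.sqrt P.D * r + Real.sqrt EW) ^ 2)
    (hV₀Bdef : V₀B = (Real.sqrt (Wb n + (MuK + P.δ n / ωK) ^ 2) + r / Real.sqrt (1 - Real.exp (-θ'))) ^ 2)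
    (hENdef : EN = Real.exp (P.θV * ((1 : ℝ) - P.D + P.K)) * ((1 + ε) * 1 * A ^ 2 * (A + M))
      + 1 * rI * (2 * VbarN + ε * rI * Real.sqrt (2 * VbarN) + (1 + ε) * M * rI))
    (hμN : 0 < μN)
    (hμNle : μN ≤ (1 / c₀) * P.θV - 2 * (1 + ε) * 1 * (A * Real.sinh (P.θV / 2) + M * (3 + Real.exp P.θV)))
    (hμB : 0 < μB) (hμBle : μB ≤ (1 / c₀) * θ' - 2 * (1 + ε) * Aeff * Real.sinh (θ' / 2))
    (hlevN : V₀N + EN * c₀ < VbarN) (hlevB : V₀B + A₁ * A₀ * (A₁ + ε * A₀) * c₀ < VbarB)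
    (hclose : Real.sqrt (2 * VbarB) * Real.exp (θ' / 2) ≤ Aeff)
    -- ONE premise, a sub-horizon, its section datum and its core input on `[0, t']`
    {z S₀ : Fin 2 → ℤ → ℝ} {τ : ℝ} {S F : Fin 2 → ℤ → ℝ → ℝ}
    (hprem : HopPremiseWith P Bcl shiftSetFlat ε₀ i₀ (mirrorTable ε ε) X₀ w r c₀ ζ ustar n z S₀ τ S F)
    {t' : ℝ} (ht' : 0 < t') (ht'c : t' ≤ c₀)
    (hsec : ∀ i, |(S - W z) i (1 - (P.K : ℤ)) 0| ≤ rs)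
    (hρ : ∀ s ∈ Icc 0 t', |(S - W z) 0 (2 - (P.K : ℤ)) s| ≤ RHO2) :
    ∀ s ∈ Icc 0 t', |(S - W z) 0 (1 - (P.K : ℤ)) s| ≤ RBAR ∧ |(S - W z) 1 (1 - (P.K : ℤ)) s| ≤ BBAR := by
  obtain ⟨hz, hkick, hc₀τ, hflow⟩ := hprem
  have hzW : InTubeWith P Bcl i₀ X₀ w r ζ ustar n z := hz
  have h0 : n ≠ 0 := by omega
  have h1 : ¬ n ≤ P.N₀ := by omega
  simp only [InTubeWith, h0, if_false, h1] at hz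
  obtain ⟨hanch, hcoreCl, hnearCl, hbeh', -⟩ := hz
  have hbeh := hBcl n z hbeh'
  have hWz := hWflow z hzW
  -- restrict both flows to `[0, t']`
  have hS' := pseudoFlowOnShift_mono hflow ht' (ht'c.trans hc₀τ)
  have hW' := pseudoFlowOnShift_mono hWz ht' (ht'c.trans hcW)
  have hkick' : ∀ i k, |S₀ i k - z i k| ≤ r := by
    intro i k
    calc |S₀ i k - z i k| = 1 * |S₀ i k - z i k| := (one_mul _).symm
      _ ≤ w k * |S₀ i k - z i k| := mul_le_mul_of_nonneg_right (hw1 k) (abs_nonneg _)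
      _ ≤ r := hkick i k
  -- the STARTS from `H(n)`
  have hstartN : coMovingEnergyOn (Finset.Icc (1 - (P.D : ℤ)) (-(P.K : ℤ))) P.θV (-(P.K : ℝ)) (S - W z) 0 ≤ V₀N := by
    have h := sqrt_initial_coMovingEnergyOn_le_additive P hflow.init_S hWz.init_S hθV.le hDK hnearCl hcoreCl hωK hωKle
      (fun i k _ => hkick' i k) hr0 (hEW z hzW)
    have hnn : 0 ≤ coMovingEnergyOn (Finset.Icc (1 - (P.D : ℤ)) (-(P.K : ℤ))) P.θV (-(P.K : ℝ)) (S - W z) 0 :=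
      coMovingEnergyOn_nonneg _ _ _ _ _
    rw [hV₀Ndef]
    calc coMovingEnergyOn (Finset.Icc (1 - (P.D : ℤ)) (-(P.K : ℤ))) P.θV (-(P.K : ℝ)) (S - W z) 0
        = Real.sqrt (coMovingEnergyOn (Finset.Icc (1 - (P.D : ℤ)) (-(P.K : ℤ))) P.θV (-(P.K : ℝ)) (S - W z) 0) ^ 2 :=
          (Real.sq_sqrt hnn).symm
      _ ≤ _ := pow_le_pow_left₀ (Real.sqrt_nonneg _) h 2
  have haK : ∀ i, |z i (-(P.K : ℤ))| ≤ MuK + P.δ n / ωK := fun i =>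
    abs_windowBottom_le_of_clauses P hAstar hanch hcoreCl hωK hωKle hMuK i
  have hstartB : ∀ L : ℕ, coMovingEnergyOn (Finset.Icc (1 - (P.K : ℤ) - L) (-(P.K : ℤ))) θ' (-(P.K : ℝ)) S 0
      ≤ V₀B := by
    intro L
    rw [hV₀Bdef]
    exact R54.initial_blockEnergy_le_additive hflow.init_S hθ hbeh.1 hWbn haK (fun i k _ => hkick' i k) hr0
  -- the interface loop on `[0, t']`
  rw [hENdef] at hlevN
  exact R54.interface_apriori_of_pseudoFlows hW' hS' hε hε₀ hK hDK hθV hθ.le hθ5 hAeff ht' le_rfl ht'c hM0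
    (fun s hs => hM z hzW s ⟨hs.1, hs.2.trans ht'c⟩) (fun s hs => hM₁ z hzW s ⟨hs.1, hs.2.trans ht'c⟩) hM₂0
    (fun s hs => hM₂ z hzW s ⟨hs.1, hs.2.trans ht'c⟩) hsec hρ0 hρ hRB0 hBB0 hRr hBr hVN0 hI₁0 hI₂0 hI₁ hI₂
    hPUMPdef hlevC hlevV hAdef hA₀def hA₁def hrA hA₀le hstartN hstartB hμN hμNle hμB hμBle hlevN hlevB hclose

set_option maxHeartbeats 400000 in
/-- **THE SAME FOR ONE KICK-BALL FLOW, loop horizon and closing horizon separated.** For a flow on `[0, τ]` from a kick-ball state of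
`H(n)` (`n > N₀`, `Bcl ⇒ behindR54`), `0 < t' ≤ τ`, `t' ≤ c₀` (the closings stay at `c₀`): section datum and core input on `[0, t']`
give the interface deviations `≤ (RBAR, BBAR)` on `[0, t']` — the form the SHORT flows of the K4 argument need.
[cite: Tao2016AveragedNS, §4 (4.1), (4.3), (4.5), (4.8), §6.3–6.4 (statement shape); cell LADDER §59–§61 (interface loop), §70 (A70-3, W-34)] -/
theorem interfaceLevels_flow_at (P : TubeSchedule) {θ' : ℝ} {Wb : ℕ → ℝ} {i₀ : Fin 2}
    {Bcl : ℕ → (Fin 2 → ℤ → ℝ) → Prop} (hBcl : ∀ m z, Bcl m z → behindR54 P θ' Wb m z)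
    {X₀ : Fin 2 → ℝ} {w : ℤ → ℝ} {r c₀ : ℝ} {ζ : ℕ → Fin 2 → ℤ → ℝ} {ustar : Fin 2 → ℤ → ℝ} {n : ℕ}
    {cW κ₂ : ℝ} {W₀ FW₀ BW₀ : (Fin 2 → ℤ → ℝ) → Fin 2 → ℤ → ℝ} {W FW : (Fin 2 → ℤ → ℝ) → Fin 2 → ℤ → ℝ → ℝ}
    (hWflow : ∀ z, InTubeWith P Bcl i₀ X₀ w r ζ ustar n z →
      PseudoFlowOnShift shiftSetFlat cW ε₀ (mirrorTable ε ε) 0 κ₂ (W₀ z) (FW₀ z) (BW₀ z) (W z) (FW z)) (hcW : c₀ ≤ cW)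
    (hε : 0 ≤ ε) (hε₀ : 0 < ε₀) (hn : P.N₀ < n) (hK : 1 ≤ P.K) (hDK : P.K + 1 ≤ P.D) (hθV : 0 < P.θV)
    (hθ : 0 < θ') (hθ5 : θ' ≤ 5 * Real.log (1 + ε₀)) (hw1 : ∀ k, 1 ≤ w k) (hr0 : 0 ≤ r)
    (hAstar : 0 < P.Astar) {ωK MuK : ℝ} (hωK : 0 < ωK)
    (hωKle : ∀ i, ωK ≤ MirrorPulse.geomGauge P.g P.b i (-(P.K : ℤ))) (hMuK : ∀ i, |ustar i (-(P.K : ℤ))| ≤ MuK)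
    (hWbn : 0 ≤ Wb n)
    {Aeff A A₀ A₁ M M₁ M₂ rI RBAR BBAR RHO2 rs I₁ I₂ PUMP μN μB VbarN VbarB EW V₀N V₀B EN : ℝ}
    (hAeff : 0 < Aeff) (hM0 : 0 ≤ M)
    (hM : ∀ z, InTubeWith P Bcl i₀ X₀ w r ζ ustar n z →
      ∀ s ∈ Icc 0 c₀, ∀ i, ∀ m ∈ Finset.Icc (-(P.D : ℤ)) (1 - (P.K : ℤ)), |W z i m s| ≤ M)
    (hM₁ : ∀ z, InTubeWith P Bcl i₀ X₀ w r ζ ustar n z → ∀ s ∈ Icc 0 c₀, |W z 1 (-(P.K : ℤ)) s| ≤ M₁)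
    (hM₂0 : 0 ≤ M₂)
    (hM₂ : ∀ z, InTubeWith P Bcl i₀ X₀ w r ζ ustar n z → ∀ s ∈ Icc 0 c₀, |W z 0 (2 - (P.K : ℤ)) s| ≤ M₂)
    (hEW : ∀ z, InTubeWith P Bcl i₀ X₀ w r ζ ustar n z →
      coMovingEnergyOn (Finset.Icc (1 - (P.D : ℤ)) (-(P.K : ℤ))) P.θV (-(P.K : ℝ))
        (fun i k _ => anchorScale P i₀ z * ustar i k - W₀ z i k) 0 ≤ EW)
    (hρ0 : 0 ≤ RHO2)
    (hRB0 : 0 ≤ RBAR) (hBB0 : 0 ≤ BBAR) (hRr : RBAR ≤ rI) (hBr : BBAR ≤ rI) (hVN0 : 0 ≤ VbarN)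
    (hI₁0 : 0 ≤ I₁) (hI₂0 : 0 ≤ I₂)
    (hI₁ : 2 * (Real.exp (P.θV / 2) - 1) ≤ I₁ * P.θV) (hI₂ : Real.exp P.θV - 1 ≤ I₂ * P.θV)
    (hPUMPdef : PUMP = 1 * c₀ * ((2 + ε) * M * I₁ * Real.sqrt (2 * VbarN) + 2 * I₂ * VbarN))
    (hlevC : rs + PUMP + 1 * c₀ * ((ε * (M + I₁ * Real.sqrt (2 * VbarN)) + ε * M + ε * BBAR) * RBAR
      + (2 + ε) * M * BBAR + BBAR ^ 2) < RBAR)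
    (hlevV : rs + 1 * c₀ * ((M + M₂ + RBAR + RHO2) * BBAR + (1 + 2 * ε) * M * RBAR + ε * RBAR ^ 2
      + (M + 2 * ε * M₂) * RHO2 + ε * RHO2 ^ 2) < BBAR)
    (hAdef : A = Real.sqrt (2 * VbarB) * Real.exp (θ' / 2) * Real.exp (θ' * ((P.D : ℝ) - P.K) / 2) + M)
    (hA₀def : A₀ = M + rI) (hA₁def : A₁ = M₁ + Real.sqrt (2 * VbarN) * Real.exp (P.θV / 2))
    (hrA : rI ≤ A) (hA₀le : A₀ ≤ Aeff)
    (hV₀Ndef : V₀N = (Real.sqrt (P.v n + (P.δ n / ωK) ^ 2) + Real.sqrt P.D * r + Real.sqrt EW) ^ 2)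
    (hV₀Bdef : V₀B = (Real.sqrt (Wb n + (MuK + P.δ n / ωK) ^ 2) + r / Real.sqrt (1 - Real.exp (-θ'))) ^ 2)
    (hENdef : EN = Real.exp (P.θV * ((1 : ℝ) - P.D + P.K)) * ((1 + ε) * 1 * A ^ 2 * (A + M))
      + 1 * rI * (2 * VbarN + ε * rI * Real.sqrt (2 * VbarN) + (1 + ε) * M * rI))
    (hμN : 0 < μN)
    (hμNle : μN ≤ (1 / c₀) * P.θV - 2 * (1 + ε) * 1 * (A * Real.sinh (P.θV / 2) + M * (3 + Real.exp P.θV)))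
    (hμB : 0 < μB) (hμBle : μB ≤ (1 / c₀) * θ' - 2 * (1 + ε) * Aeff * Real.sinh (θ' / 2))
    (hlevN : V₀N + EN * c₀ < VbarN) (hlevB : V₀B + A₁ * A₀ * (A₁ + ε * A₀) * c₀ < VbarB)
    (hclose : Real.sqrt (2 * VbarB) * Real.exp (θ' / 2) ≤ Aeff)
    -- ONE kick-ball flow of `H(n)` on `[0, τ]`, a loop horizon `t' ≤ τ`, `t' ≤ c₀`, its section datum and core input on `[0, t']`
    {z S₀ : Fin 2 → ℤ → ℝ} {τ : ℝ} {S F : Fin 2 → ℤ → ℝ → ℝ} (hz : InTubeWith P Bcl i₀ X₀ w r ζ ustar n z)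
    (hkick : ∀ i k, w k * |S₀ i k - z i k| ≤ r)
    (hflow : PseudoFlowOnShift shiftSetFlat τ ε₀ (mirrorTable ε ε) 0 0 S₀ (fun i k => (1 / 2) * S₀ i k ^ 2) (fun _ _ => 0) S F)
    {t' : ℝ} (ht' : 0 < t') (ht'τ : t' ≤ τ) (ht'c : t' ≤ c₀)
    (hsec : ∀ i, |(S - W z) i (1 - (P.K : ℤ)) 0| ≤ rs)
    (hρ : ∀ s ∈ Icc 0 t', |(S - W z) 0 (2 - (P.K : ℤ)) s| ≤ RHO2) :
    ∀ s ∈ Icc 0 t', |(S - W z) 0 (1 - (P.K : ℤ)) s| ≤ RBAR ∧ |(S - W z) 1 (1 - (P.K : ℤ)) s| ≤ BBAR := by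
  have hzW : InTubeWith P Bcl i₀ X₀ w r ζ ustar n z := hz
  have h0 : n ≠ 0 := by omega
  have h1 : ¬ n ≤ P.N₀ := by omega
  simp only [InTubeWith, h0, if_false, h1] at hz
  obtain ⟨hanch, hcoreCl, hnearCl, hbeh', -⟩ := hz
  have hbeh := hBcl n z hbeh'
  have hWz := hWflow z hzW
  -- restrict both flows to `[0, t']`
  have hS' := pseudoFlowOnShift_mono hflow ht' ht'τ
  have hW' := pseudoFlowOnShift_mono hWz ht' (ht'c.trans hcW)
  have hkick' : ∀ i k, |S₀ i k - z i k| ≤ r := by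
    intro i k
    calc |S₀ i k - z i k| = 1 * |S₀ i k - z i k| := (one_mul _).symm
      _ ≤ w k * |S₀ i k - z i k| := mul_le_mul_of_nonneg_right (hw1 k) (abs_nonneg _)
      _ ≤ r := hkick i k
  -- the STARTS from `H(n)`
  have hstartN : coMovingEnergyOn (Finset.Icc (1 - (P.D : ℤ)) (-(P.K : ℤ))) P.θV (-(P.K : ℝ)) (S - W z) 0 ≤ V₀N := by
    have h := sqrt_initial_coMovingEnergyOn_le_additive P hflow.init_S hWz.init_S hθV.le hDK hnearCl hcoreCl hωK hωKle
      (fun i k _ => hkick' i k) hr0 (hEW z hzW)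
    have hnn : 0 ≤ coMovingEnergyOn (Finset.Icc (1 - (P.D : ℤ)) (-(P.K : ℤ))) P.θV (-(P.K : ℝ)) (S - W z) 0 :=
      coMovingEnergyOn_nonneg _ _ _ _ _
    rw [hV₀Ndef]
    calc coMovingEnergyOn (Finset.Icc (1 - (P.D : ℤ)) (-(P.K : ℤ))) P.θV (-(P.K : ℝ)) (S - W z) 0
        = Real.sqrt (coMovingEnergyOn (Finset.Icc (1 - (P.D : ℤ)) (-(P.K : ℤ))) P.θV (-(P.K : ℝ)) (S - W z) 0) ^ 2 :=
          (Real.sq_sqrt hnn).symm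
      _ ≤ _ := pow_le_pow_left₀ (Real.sqrt_nonneg _) h 2
  have haK : ∀ i, |z i (-(P.K : ℤ))| ≤ MuK + P.δ n / ωK := fun i =>
    abs_windowBottom_le_of_clauses P hAstar hanch hcoreCl hωK hωKle hMuK i
  have hstartB : ∀ L : ℕ, coMovingEnergyOn (Finset.Icc (1 - (P.K : ℤ) - L) (-(P.K : ℤ))) θ' (-(P.K : ℝ)) S 0
      ≤ V₀B := by
    intro L
    rw [hV₀Bdef]
    exact R54.initial_blockEnergy_le_additive hflow.init_S hθ hbeh.1 hWbn haK (fun i k _ => hkick' i k) hr0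
  -- the interface loop on `[0, t']`
  rw [hENdef] at hlevN
  exact R54.interface_apriori_of_pseudoFlows hW' hS' hε hε₀ hK hDK hθV hθ.le hθ5 hAeff ht' le_rfl ht'c hM0
    (fun s hs => hM z hzW s ⟨hs.1, hs.2.trans ht'c⟩) (fun s hs => hM₁ z hzW s ⟨hs.1, hs.2.trans ht'c⟩) hM₂0
    (fun s hs => hM₂ z hzW s ⟨hs.1, hs.2.trans ht'c⟩) hsec hρ0 hρ hRB0 hBB0 hRr hBr hVN0 hI₁0 hI₂0 hI₁ hI₂
    hPUMPdef hlevC hlevV hAdef hA₀def hA₁def hrA hA₀le hstartN hstartB hμN hμNle hμB hμBle hlevN hlevB hclose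

end Flow

end Summit.NavierStokesRegularity.NavierStokesRegularity.Theorems.HopTube

end
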